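import Summits.QuantumAdvantage.QuantumAdvantage.Theorems.LinnikCubicClassGroupsDegreeOnePrimesEscapeShortIntervalBookkeeping
import HarnessLib

/-!
# The Chebotarev density theorem in short intervals, conjugacy classes: the real-variable bookkeeping

Topic `Summits/QuantumAdvantage/QuantumAdvantage/Theorems`, cell B2b-1 (linnik-cubic), PART A (gen 17);
helper toward the crux `DegreeOnePrimesEscape` (stmt-QuantumAdvantage-11543) of route
`LinnikCubicClassGroups`.  HONEST FRAMING: the value of this file is a THEOREM (kernel-checked lemmas of
real analysis) — NOT summit progress.

`…ShortIntervalBookkeeping.lean` (gen 5, ideal classes) bounds the error of the smoothed short-interval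
estimate of one window by `e^L η/8` with the fixed collar `ε = η/4`.  For the conjugacy-class version
(files `…FrobeniusWindow*.lean`), whose main term is shared by the `m ≤ n` characters of a cyclic
sub-extension and whose unsmoothing must be accurate to a prescribed relative precision, we need the same
bookkeeping with a general collar `ε = ε₀ η` (`0 < ε₀ ≤ 1/4`) and prescribed precision targets:
`frobWindow_bookkeeping` (flat part `≤ κ₁`, absorption `≤ κ₂` ⟹ error `≤ e^L η (9κ₁/2 + κ₂)`) and
`frobWindow_range` (the range condition `e^{b(a log Q + log(T₁+4))} ≤ X^{1/2}`).  Pure real analysis.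
-/

noncomputable section

open Real

namespace Summit.QuantumAdvantage.QuantumAdvantage.Theorems.DegreeOnePrimesEscape

set_option maxHeartbeats 1600000 in
/-- **The bookkeeping of one window with a general collar `ε = ε₀ η` and prescribed precision, in real variables** (a copy of `window_bookkeeping`, gen 5, with `1/64 ↦ κ₁`, `1/32 ↦ κ₂`, `ε = η/4 ↦ ε = ε₀η`, `0 < ε₀ ≤ 1/4`).  All quantities of the error term
`Bf + h_K (M₀ + J)` of the smoothed short-interval estimate are real parameters here (`Q`, `L = log x`,
`η`, the window `lo < hi`, `ε = η/4`, `ℓ`, `L_X = hi + ε`, `X = e^{L_X}`, `T₁ = X^θ`, the density and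
package constants); under the size hypotheses (`a log Q ≤ θ L`, `2 ≤ θ L`, `e^{−θL/8} ≤ 2η`, the absorption
inequality) the error is `≤ e^L η (9κ₁/2 + κ₂)`.  Terms: flat part `≤ (9/2) κ₁ e^L η`, and the four secondary terms
`≤ C_J Q⁷ (L+1) e^{(1−θ/4)L} η ≤ κ₂ e^L η`. [folklore] -/
theorem frobWindow_bookkeeping {Q L η θ M A_L W₀ lLC c₁ c₂ D c a hK AK logd nK lo hi X T₁ ε ℓ LX ε₀ κ₁ κ₂ : ℝ}
    (hQ12 : 12 ≤ Q) (hM1 : 1 ≤ M) (hAL : 0 < A_L) (hW₀0 : 0 < W₀) (hlC : 0 ≤ lLC) (hc₁ : 16 ≤ c₁)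
    (hc₂ : 0 ≤ c₂) (hD : 0 < D) (hc : 0 < c) (ha : 1 ≤ a)
    (hhK : hK ≤ Q ^ (4 : ℕ)) (hhK0 : 0 ≤ hK) (hAK : AK = logd + 3 * nK) (hAK4 : AK ≤ 4 * Q)
    (hlogd0 : 0 ≤ logd) (hnQ : nK ≤ Q) (hn0 : 0 ≤ nK)
    (hθ0 : 0 < θ) (hθ1 : θ ≤ 1 / 8)
    (hθflat : 2 * Real.exp 1 * D * Real.exp (-(c / (6 * θ))) ≤ κ₁)
    (haθ : a * Real.log Q ≤ θ * L) (h2θ : 2 ≤ θ * L)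
    (hη0 : 0 < η) (hη1 : η ≤ Real.log 2) (hηL : Real.exp (-(θ / 8) * L) ≤ 2 * η)
    (hε₀ : 0 < ε₀) (hε₀1 : ε₀ ≤ 1 / 4)
    (habs : (338 * W₀ + 96 * (M / (4 * ε₀)) * W₀ * (4 * c₁ + c₂) + 108 + 640 * lLC * A_L * (M / (4 * ε₀))) *
      Q ^ (7 : ℕ) * (L + 1) * Real.exp (-(θ / 4) * L) ≤ κ₂)
    (hlo : L ≤ lo) (hlohi : lo < hi) (hhi : hi ≤ L + η)
    (hε : ε = ε₀ * η) (hℓ : ℓ = hi - lo + 2 * ε) (hLX : LX = hi + ε) (hX : X = Real.exp LX)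
    (hT₁ : T₁ = Real.exp (θ * LX)) :
    X * (ℓ * (2 * Real.exp 1 * D * Real.exp (-(c * LX / (2 * (a * Real.log Q + Real.log (T₁ + 4)))))) +
        ℓ * X ^ (-(3 : ℝ) / 4) * (hK * ((2 * T₁ + 3) * (W₀ * (AK + Real.log (T₁ + 5))))) +
        (2 * M / ε) * T₁ ^ (-((1 : ℝ) / 2)) * (hK * (W₀ * (c₁ * AK + c₂)))) +
      hK * (64 * Q * ℓ + lLC * (A_L * (nK + 1)) * (logd + Real.log 4 + 1) * (Real.exp (-((lo - ε) / 2)) * (2 * M / ε)))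
      ≤ Real.exp L * η * (9 / 2 * κ₁ + κ₂) := by
  have hQ1 : (1 : ℝ) ≤ Q := by linarith
  have hQ0 : (0 : ℝ) < Q := by linarith
  have hM0 : 0 ≤ M := by linarith
  set M' : ℝ := M / (4 * ε₀) with hM'
  have hM'0 : 0 ≤ M' := by rw [hM']; positivity
  have hc₁0 : 0 ≤ c₁ := by linarith
  -- `L ≥ 16`
  have hθL8 : θ * L ≤ L / 8 := by
    have hL0' : 0 ≤ L := by
      by_contra h; rw [not_le] at h
      have := mul_neg_of_pos_of_neg hθ0 h; linarith
    have := mul_le_mul_of_nonneg_right hθ1 hL0'; linarith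
  have hL16 : 16 ≤ L := by linarith
  have hL0 : 0 < L := by linarith
  have hL1 : 1 ≤ L + 1 := by linarith
  -- numerics
  have he1 : Real.exp 1 < 2.7182818286 := Real.exp_one_lt_d9
  have he1' : 2.7182818283 < Real.exp 1 := Real.exp_one_gt_d9
  have hlog2 : Real.log 2 < 0.6931471808 := Real.log_two_lt_d9
  have hη07 : η < 0.7 := by linarith
  obtain ⟨hlog6, hlog4, hlog12⟩ := log_small_consts
  have hlogQ2 : 2 ≤ Real.log Q := hlog12.trans (Real.log_le_log (by norm_num) hQ12)
  -- `ε`, `ℓ`, `L_X`, `X`, `T₁`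
  have hε0 : 0 < ε := by rw [hε]; positivity
  have hε4 : ε ≤ η / 4 := by
    rw [hε]; have := mul_le_mul_of_nonneg_right hε₀1 hη0.le; linarith
  have hε' : 2 * M / ε = 8 * M' / η := by rw [hε, hM']; field_simp; norm_num
  have hℓη : ℓ ≤ 3 * η / 2 := by rw [hℓ]; linarith
  have hℓ0 : 0 < ℓ := by rw [hℓ]; linarith
  have hLXL : L ≤ LX := by rw [hLX]; linarith
  have hLXU : LX ≤ L + 5 * η / 4 := by rw [hLX]; linarith
  have hLX1 : LX ≤ L + 1 := by linarith
  have hLX0 : 0 < LX := by linarith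
  have hX0 : 0 < X := by rw [hX]; exact Real.exp_pos _
  have he3 : Real.exp (5 * η / 4) ≤ 3 := by
    have : 5 * η / 4 ≤ 1 := by linarith
    linarith [Real.exp_le_exp.2 this]
  have hX3 : X ≤ 3 * Real.exp L := by
    rw [hX]
    calc Real.exp LX ≤ Real.exp (L + 5 * η / 4) := Real.exp_le_exp.2 hLXU
      _ = Real.exp L * Real.exp (5 * η / 4) := Real.exp_add _ _
      _ ≤ Real.exp L * 3 := mul_le_mul_of_nonneg_left he3 (Real.exp_pos _).le
      _ = 3 * Real.exp L := by ring
  have hθLX : 0 ≤ θ * LX := by positivity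
  have hT₁1 : 1 ≤ T₁ := by rw [hT₁]; exact Real.one_le_exp hθLX
  have hθLXL : θ * L ≤ θ * LX := mul_le_mul_of_nonneg_left hLXL hθ0.le
  have hθLX1 : θ * LX ≤ (L + 1) / 8 := by
    have := mul_le_mul_of_nonneg_left hLX1 hθ0.le
    have h2 := mul_le_mul_of_nonneg_right hθ1 (by linarith : (0 : ℝ) ≤ L + 1)
    linarith
  have hAK0 : 0 ≤ AK := by rw [hAK]; positivity
  have hlogdQ : logd ≤ 4 * Q := by rw [hAK] at hAK4; linarith
  -- logs of `T₁ + 4`, `T₁ + 5`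
  have hlogT4 : Real.log (T₁ + 4) ≤ θ * LX + 2 := by
    have h2 : Real.log (T₁ + 4) ≤ Real.log (6 * T₁) := Real.log_le_log (by linarith) (by linarith)
    rw [Real.log_mul (by norm_num) (by linarith), hT₁, Real.log_exp] at h2
    rw [hT₁]; linarith
  have hlogT5 : Real.log (T₁ + 5) ≤ θ * LX + 2 := by
    have h2 : Real.log (T₁ + 5) ≤ Real.log (6 * T₁) := Real.log_le_log (by linarith) (by linarith)
    rw [Real.log_mul (by norm_num) (by linarith), hT₁, Real.log_exp] at h2
    rw [hT₁]; linarith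
  have haQ : Real.log Q ≤ a * Real.log Q := le_mul_of_one_le_left (by linarith) ha
  have hden : a * Real.log Q + Real.log (T₁ + 4) ≤ 3 * (θ * LX) := by linarith
  have hden0 : 0 < a * Real.log Q + Real.log (T₁ + 4) := by
    have : 0 ≤ Real.log (T₁ + 4) := Real.log_nonneg (by linarith)
    linarith
  -- `R = Q⁷ (L+1) e^{(1−θ/4)L} η` and the absorption hypothesis
  set R : ℝ := Q ^ (7 : ℕ) * (L + 1) * Real.exp ((1 - θ / 4) * L) * η with hR
  have hR0 : 0 < R := by positivity
  have hη2L : Real.exp (-(θ / 4) * L) ≤ 4 * η ^ 2 := by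
    have h := mul_le_mul hηL hηL (Real.exp_pos _).le (by positivity)
    rw [← Real.exp_add] at h
    rw [show -(θ / 4) * L = -(θ / 8) * L + -(θ / 8) * L by ring]
    linarith
  have habs' : (338 * W₀ + 96 * M' * W₀ * (4 * c₁ + c₂) + 108 + 640 * lLC * A_L * M') * R ≤
      Real.exp L * η * κ₂ := by
    have h := mul_le_mul_of_nonneg_right habs (by positivity : (0 : ℝ) ≤ Real.exp L * η)
    rw [hR, show (1 - θ / 4) * L = L + -(θ / 4) * L by ring, Real.exp_add]
    calc _ = (338 * W₀ + 96 * (M / (4 * ε₀)) * W₀ * (4 * c₁ + c₂) + 108 + 640 * lLC * A_L * (M / (4 * ε₀))) *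
          Q ^ (7 : ℕ) * (L + 1) * Real.exp (-(θ / 4) * L) * (Real.exp L * η) := by rw [hM']; ring
      _ ≤ κ₂ * (Real.exp L * η) := h
      _ = Real.exp L * η * κ₂ := by ring
  -- common numerical facts
  have hQ57 : Q ^ (4 : ℕ) * Q ≤ Q ^ (7 : ℕ) := by
    have h1 : Q ^ (4 : ℕ) * Q = Q ^ (5 : ℕ) := by ring
    rw [h1]; exact pow_le_pow_right₀ hQ1 (by norm_num)
  have hQ67 : Q ^ (4 : ℕ) * Q * Q ≤ Q ^ (7 : ℕ) := by
    have h1 : Q ^ (4 : ℕ) * Q * Q = Q ^ (6 : ℕ) := by ring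
    rw [h1]; exact pow_le_pow_right₀ hQ1 (by norm_num)
  have hexpL1 : 1 ≤ Real.exp ((1 - θ / 4) * L) := Real.one_le_exp (mul_nonneg (by linarith) hL0.le)
  have hQ7R : Q ^ (4 : ℕ) * Q * η ≤ R := by
    rw [hR]
    have h1 : Q ^ (4 : ℕ) * Q * η ≤ Q ^ (7 : ℕ) * η := mul_le_mul_of_nonneg_right hQ57 hη0.le
    have h2 : Q ^ (7 : ℕ) ≤ Q ^ (7 : ℕ) * (L + 1) * Real.exp ((1 - θ / 4) * L) := by
      calc Q ^ (7 : ℕ) = Q ^ (7 : ℕ) * 1 * 1 := by ring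
        _ ≤ Q ^ (7 : ℕ) * (L + 1) * Real.exp ((1 - θ / 4) * L) :=
            mul_le_mul (mul_le_mul_of_nonneg_left hL1 (by positivity)) hexpL1 (by norm_num) (by positivity)
    have h3 := mul_le_mul_of_nonneg_right h2 hη0.le
    linarith
  -- (1) the flat term
  have hflat : Real.exp (-(c * LX / (2 * (a * Real.log Q + Real.log (T₁ + 4))))) ≤ Real.exp (-(c / (6 * θ))) := by
    refine Real.exp_le_exp.2 (neg_le_neg ?_)
    rw [div_le_div_iff₀ (by positivity) (by positivity)]
    have h2 : c * (2 * (a * Real.log Q + Real.log (T₁ + 4))) ≤ c * (2 * (3 * (θ * LX))) :=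
      mul_le_mul_of_nonneg_left (by linarith) hc.le
    calc c * (2 * (a * Real.log Q + Real.log (T₁ + 4))) ≤ c * (2 * (3 * (θ * LX))) := h2
      _ = c * LX * (6 * θ) := by ring
  have hT1 : X * (ℓ * (2 * Real.exp 1 * D * Real.exp (-(c * LX / (2 * (a * Real.log Q + Real.log (T₁ + 4))))))) ≤
      9 / 2 * κ₁ * (Real.exp L * η) := by
    have h1 : 2 * Real.exp 1 * D * Real.exp (-(c * LX / (2 * (a * Real.log Q + Real.log (T₁ + 4))))) ≤ κ₁ :=
      (mul_le_mul_of_nonneg_left hflat (by positivity)).trans hθflat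
    calc X * (ℓ * (2 * Real.exp 1 * D * Real.exp (-(c * LX / (2 * (a * Real.log Q + Real.log (T₁ + 4)))))))
        ≤ (3 * Real.exp L) * ((3 * η / 2) * κ₁) :=
          mul_le_mul hX3 (mul_le_mul hℓη h1 (by positivity) (by positivity)) (by positivity) (by positivity)
      _ = 9 / 2 * κ₁ * (Real.exp L * η) := by ring
  -- (2) the `β < 1/4` junk
  have hT2 : X * (ℓ * X ^ (-(3 : ℝ) / 4) * (hK * ((2 * T₁ + 3) * (W₀ * (AK + Real.log (T₁ + 5)))))) ≤
      338 * W₀ * R := by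
    have hX34 : X * X ^ (-(3 : ℝ) / 4) = Real.exp (LX / 4) := by
      rw [hX, ← Real.exp_mul, ← Real.exp_add]; congr 1; ring
    have hT5 : 2 * T₁ + 3 ≤ 5 * Real.exp (θ * LX) := by rw [hT₁] at hT₁1 ⊢; linarith
    have hQL : 12 * L ≤ Q * L := mul_le_mul_of_nonneg_right hQ12 hL0.le
    have hAlog : AK + Real.log (T₁ + 5) ≤ 5 * Q * (L + 1) := by
      have h5 : 5 * Q * (L + 1) = 5 * (Q * L) + 5 * Q := by ring
      rw [h5]; linarith
    have hexp1 : Real.exp (LX / 4) * Real.exp (θ * LX) ≤ Real.exp 1 * Real.exp ((1 - θ / 4) * L) := by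
      rw [← Real.exp_add, ← Real.exp_add]
      refine Real.exp_le_exp.2 ?_
      have h1 : LX / 4 + θ * LX ≤ (1 / 4 + θ) * (L + 1) := by
        have := mul_le_mul_of_nonneg_left hLX1 (by positivity : (0 : ℝ) ≤ 1 / 4 + θ); linarith
      linarith
    have hlogT50 : 0 ≤ AK + Real.log (T₁ + 5) := by
      have : 0 ≤ Real.log (T₁ + 5) := Real.log_nonneg (by linarith)
      positivity
    calc X * (ℓ * X ^ (-(3 : ℝ) / 4) * (hK * ((2 * T₁ + 3) * (W₀ * (AK + Real.log (T₁ + 5))))))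
        = (X * X ^ (-(3 : ℝ) / 4)) * ℓ * (hK * ((2 * T₁ + 3) * (W₀ * (AK + Real.log (T₁ + 5))))) := by ring
      _ ≤ Real.exp (LX / 4) * (3 * η / 2) * (Q ^ (4 : ℕ) * ((5 * Real.exp (θ * LX)) * (W₀ * (5 * Q * (L + 1))))) := by
          rw [hX34]
          refine mul_le_mul (mul_le_mul_of_nonneg_left hℓη (Real.exp_pos _).le) ?_ (by positivity) (by positivity)
          exact mul_le_mul hhK (mul_le_mul hT5 (mul_le_mul_of_nonneg_left hAlog hW₀0.le) (by positivity)
            (by positivity)) (by positivity) (by positivity)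
      _ = (75 / 2) * W₀ * ((L + 1) * η) * ((Q ^ (4 : ℕ) * Q) * (Real.exp (LX / 4) * Real.exp (θ * LX))) := by ring
      _ ≤ (75 / 2) * W₀ * ((L + 1) * η) * (Q ^ (7 : ℕ) * (Real.exp 1 * Real.exp ((1 - θ / 4) * L))) :=
          mul_le_mul_of_nonneg_left (mul_le_mul hQ57 hexp1 (by positivity) (by positivity)) (by positivity)
      _ = (75 / 2 * Real.exp 1) * (W₀ * R) := by rw [hR]; ring
      _ ≤ 338 * (W₀ * R) := mul_le_mul_of_nonneg_right (by linarith) (by positivity)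
      _ = 338 * W₀ * R := by ring
  -- (3) the tail `|γ| > T₁`
  have hT3 : X * ((2 * M / ε) * T₁ ^ (-((1 : ℝ) / 2)) * (hK * (W₀ * (c₁ * AK + c₂)))) ≤
      96 * M' * W₀ * (4 * c₁ + c₂) * R := by
    have hT12 : T₁ ^ (-((1 : ℝ) / 2)) = Real.exp (-(θ * LX / 2)) := by
      rw [hT₁, ← Real.exp_mul]; congr 1; ring
    have hcA : c₁ * AK + c₂ ≤ (4 * c₁ + c₂) * Q := by
      have h1 : c₁ * AK ≤ c₁ * (4 * Q) := mul_le_mul_of_nonneg_left hAK4 hc₁0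
      have h2 : c₂ ≤ c₂ * Q := le_mul_of_one_le_right hc₂ hQ1
      have h3 : (4 * c₁ + c₂) * Q = c₁ * (4 * Q) + c₂ * Q := by ring
      rw [h3]; linarith
    have h4c0 : 0 ≤ 4 * c₁ + c₂ := by positivity
    have hXexp : X * Real.exp (-(θ * LX / 2)) ≤ Real.exp 1 * Real.exp ((1 - θ / 2) * L) := by
      rw [hX, ← Real.exp_add, ← Real.exp_add]
      refine Real.exp_le_exp.2 ?_
      have := mul_le_mul_of_nonneg_left hLX1 (by linarith : (0 : ℝ) ≤ 1 - θ / 2)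
      linarith
    have hRη : Q ^ (7 : ℕ) * Real.exp ((1 - θ / 2) * L) ≤ 4 * (R * η) := by
      rw [hR]
      have h1 : Real.exp ((1 - θ / 2) * L) = Real.exp ((1 - θ / 4) * L) * Real.exp (-(θ / 4) * L) := by
        rw [← Real.exp_add]; congr 1; ring
      rw [h1]
      have h2 : Real.exp ((1 - θ / 4) * L) * Real.exp (-(θ / 4) * L) ≤
          Real.exp ((1 - θ / 4) * L) * (4 * η ^ 2) := mul_le_mul_of_nonneg_left hη2L (Real.exp_pos _).le
      have h3 : Q ^ (7 : ℕ) ≤ Q ^ (7 : ℕ) * (L + 1) := le_mul_of_one_le_right (by positivity) hL1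
      calc Q ^ (7 : ℕ) * (Real.exp ((1 - θ / 4) * L) * Real.exp (-(θ / 4) * L))
          ≤ (Q ^ (7 : ℕ) * (L + 1)) * (Real.exp ((1 - θ / 4) * L) * (4 * η ^ 2)) :=
            mul_le_mul h3 h2 (by positivity) (by positivity)
        _ = 4 * (Q ^ (7 : ℕ) * (L + 1) * Real.exp ((1 - θ / 4) * L) * η * η) := by ring
    have hkey : 8 * M' * (X * Real.exp (-(θ * LX / 2)) * (Q ^ (4 : ℕ) * (W₀ * ((4 * c₁ + c₂) * Q)))) ≤
        (96 * M' * W₀ * (4 * c₁ + c₂) * R) * η := by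
      calc 8 * M' * (X * Real.exp (-(θ * LX / 2)) * (Q ^ (4 : ℕ) * (W₀ * ((4 * c₁ + c₂) * Q))))
          = 8 * M' * W₀ * (4 * c₁ + c₂) * ((Q ^ (4 : ℕ) * Q) * (X * Real.exp (-(θ * LX / 2)))) := by ring
        _ ≤ 8 * M' * W₀ * (4 * c₁ + c₂) * (Q ^ (7 : ℕ) * (Real.exp 1 * Real.exp ((1 - θ / 2) * L))) :=
            mul_le_mul_of_nonneg_left (mul_le_mul hQ57 hXexp (by positivity) (by positivity)) (by positivity)
        _ = 8 * Real.exp 1 * M' * W₀ * (4 * c₁ + c₂) * (Q ^ (7 : ℕ) * Real.exp ((1 - θ / 2) * L)) := by ring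
        _ ≤ 8 * Real.exp 1 * M' * W₀ * (4 * c₁ + c₂) * (4 * (R * η)) :=
            mul_le_mul_of_nonneg_left hRη (by positivity)
        _ = (32 * Real.exp 1) * (M' * W₀ * (4 * c₁ + c₂) * R * η) := by ring
        _ ≤ 96 * (M' * W₀ * (4 * c₁ + c₂) * R * η) := mul_le_mul_of_nonneg_right (by linarith) (by positivity)
        _ = (96 * M' * W₀ * (4 * c₁ + c₂) * R) * η := by ring
    rw [hε', hT12]
    calc X * ((8 * M' / η) * Real.exp (-(θ * LX / 2)) * (hK * (W₀ * (c₁ * AK + c₂))))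
        ≤ X * ((8 * M' / η) * Real.exp (-(θ * LX / 2)) * (Q ^ (4 : ℕ) * (W₀ * ((4 * c₁ + c₂) * Q)))) := by
          refine mul_le_mul_of_nonneg_left (mul_le_mul_of_nonneg_left
            (mul_le_mul hhK (mul_le_mul_of_nonneg_left hcA hW₀0.le) (by positivity) (by positivity))
            (by positivity)) hX0.le
      _ = (8 * M' * (X * Real.exp (-(θ * LX / 2)) * (Q ^ (4 : ℕ) * (W₀ * ((4 * c₁ + c₂) * Q))))) / η := by
          ring
      _ ≤ ((96 * M' * W₀ * (4 * c₁ + c₂) * R) * η) / η := div_le_div_of_nonneg_right hkey hη0.le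
      _ = 96 * M' * W₀ * (4 * c₁ + c₂) * R := mul_div_cancel_right₀ _ hη0.ne'
  -- (4) the trivial-zero terms
  have hTM : hK * (64 * Q * ℓ) ≤ 108 * R := by
    calc hK * (64 * Q * ℓ) ≤ Q ^ (4 : ℕ) * (64 * Q * (3 * η / 2)) :=
          mul_le_mul hhK (mul_le_mul_of_nonneg_left hℓη (by positivity)) (by positivity) (by positivity)
      _ = 96 * (Q ^ (4 : ℕ) * Q * η) := by ring
      _ ≤ 96 * R := mul_le_mul_of_nonneg_left hQ7R (by norm_num)
      _ ≤ 108 * R := by linarith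
  -- (5) the left-line integrals
  have hTJ : hK * (lLC * (A_L * (nK + 1)) * (logd + Real.log 4 + 1) * (Real.exp (-((lo - ε) / 2)) * (2 * M / ε))) ≤
      640 * lLC * A_L * M' * R := by
    have hn2 : nK + 1 ≤ 2 * Q := by linarith
    have hd5 : logd + Real.log 4 + 1 ≤ 5 * Q := by linarith
    have hd50 : 0 ≤ logd + Real.log 4 + 1 := by
      have : 0 ≤ Real.log 4 := Real.log_nonneg (by norm_num); positivity
    have hehalf : Real.exp (1 / 2) ≤ 2 := exp_half_le_two_and.1
    have hexplo : Real.exp (-((lo - ε) / 2)) ≤ 2 * Real.exp (-(L / 2)) := by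
      have h1 : -((lo - ε) / 2) ≤ 1 / 2 + -(L / 2) := by linarith
      calc Real.exp (-((lo - ε) / 2)) ≤ Real.exp (1 / 2 + -(L / 2)) := Real.exp_le_exp.2 h1
        _ = Real.exp (1 / 2) * Real.exp (-(L / 2)) := Real.exp_add _ _
        _ ≤ 2 * Real.exp (-(L / 2)) := mul_le_mul_of_nonneg_right hehalf (Real.exp_pos _).le
    have hRη : Q ^ (7 : ℕ) * Real.exp (-(L / 2)) ≤ 4 * (R * η) := by
      rw [hR]
      have h1 : Real.exp (-(L / 2)) ≤ Real.exp ((1 - θ / 4) * L) * Real.exp (-(θ / 4) * L) := by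
        rw [← Real.exp_add]; exact Real.exp_le_exp.2 (by linarith)
      have h2 : Real.exp ((1 - θ / 4) * L) * Real.exp (-(θ / 4) * L) ≤
          Real.exp ((1 - θ / 4) * L) * (4 * η ^ 2) := mul_le_mul_of_nonneg_left hη2L (Real.exp_pos _).le
      have h3 : Q ^ (7 : ℕ) ≤ Q ^ (7 : ℕ) * (L + 1) := le_mul_of_one_le_right (by positivity) hL1
      calc Q ^ (7 : ℕ) * Real.exp (-(L / 2))
          ≤ (Q ^ (7 : ℕ) * (L + 1)) * (Real.exp ((1 - θ / 4) * L) * (4 * η ^ 2)) :=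
            mul_le_mul h3 (h1.trans h2) (Real.exp_pos _).le (by positivity)
        _ = 4 * (Q ^ (7 : ℕ) * (L + 1) * Real.exp ((1 - θ / 4) * L) * η * η) := by ring
    have hkey : 8 * M' * (Q ^ (4 : ℕ) * (lLC * (A_L * (2 * Q)) * (5 * Q) * (2 * Real.exp (-(L / 2))))) ≤
        (640 * lLC * A_L * M' * R) * η := by
      calc 8 * M' * (Q ^ (4 : ℕ) * (lLC * (A_L * (2 * Q)) * (5 * Q) * (2 * Real.exp (-(L / 2)))))
          = 160 * lLC * A_L * M' * ((Q ^ (4 : ℕ) * Q * Q) * Real.exp (-(L / 2))) := by ring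
        _ ≤ 160 * lLC * A_L * M' * (Q ^ (7 : ℕ) * Real.exp (-(L / 2))) :=
            mul_le_mul_of_nonneg_left (mul_le_mul_of_nonneg_right hQ67 (Real.exp_pos _).le) (by positivity)
        _ ≤ 160 * lLC * A_L * M' * (4 * (R * η)) := mul_le_mul_of_nonneg_left hRη (by positivity)
        _ = (640 * lLC * A_L * M' * R) * η := by ring
    rw [hε']
    calc hK * (lLC * (A_L * (nK + 1)) * (logd + Real.log 4 + 1) * (Real.exp (-((lo - ε) / 2)) * (8 * M' / η)))
        ≤ Q ^ (4 : ℕ) * (lLC * (A_L * (2 * Q)) * (5 * Q) * ((2 * Real.exp (-(L / 2))) * (8 * M' / η))) := by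
          refine mul_le_mul hhK ?_ (by positivity) (by positivity)
          refine mul_le_mul (mul_le_mul (mul_le_mul_of_nonneg_left (mul_le_mul_of_nonneg_left hn2 hAL.le) hlC)
            hd5 hd50 (by positivity)) (mul_le_mul_of_nonneg_right hexplo (by positivity)) (by positivity) (by positivity)
      _ = (8 * M' * (Q ^ (4 : ℕ) * (lLC * (A_L * (2 * Q)) * (5 * Q) * (2 * Real.exp (-(L / 2)))))) / η := by
          ring
      _ ≤ ((640 * lLC * A_L * M' * R) * η) / η := div_le_div_of_nonneg_right hkey hη0.le
      _ = 640 * lLC * A_L * M' * R := mul_div_cancel_right₀ _ hη0.ne'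
  -- assemble
  have hsplit : X * (ℓ * (2 * Real.exp 1 * D * Real.exp (-(c * LX / (2 * (a * Real.log Q + Real.log (T₁ + 4)))))) +
      ℓ * X ^ (-(3 : ℝ) / 4) * (hK * ((2 * T₁ + 3) * (W₀ * (AK + Real.log (T₁ + 5))))) +
      (2 * M / ε) * T₁ ^ (-((1 : ℝ) / 2)) * (hK * (W₀ * (c₁ * AK + c₂)))) =
      X * (ℓ * (2 * Real.exp 1 * D * Real.exp (-(c * LX / (2 * (a * Real.log Q + Real.log (T₁ + 4))))))) +
      X * (ℓ * X ^ (-(3 : ℝ) / 4) * (hK * ((2 * T₁ + 3) * (W₀ * (AK + Real.log (T₁ + 5)))))) +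
      X * ((2 * M / ε) * T₁ ^ (-((1 : ℝ) / 2)) * (hK * (W₀ * (c₁ * AK + c₂)))) := by ring
  rw [hsplit, mul_add hK]
  have hjunk : 338 * W₀ * R + 96 * M' * W₀ * (4 * c₁ + c₂) * R + 108 * R + 640 * lLC * A_L * M' * R ≤
      Real.exp L * η * κ₂ := by
    have : 338 * W₀ * R + 96 * M' * W₀ * (4 * c₁ + c₂) * R + 108 * R + 640 * lLC * A_L * M' * R =
        (338 * W₀ + 96 * M' * W₀ * (4 * c₁ + c₂) + 108 + 640 * lLC * A_L * M') * R := by ring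
    rw [this]; exact habs'
  have hxη : 0 ≤ Real.exp L * η := by positivity
  have e : Real.exp L * η * (9 / 2 * κ₁ + κ₂) = 9 / 2 * κ₁ * (Real.exp L * η) + Real.exp L * η * κ₂ := by ring
  rw [e]
  linarith [hT1, hT2, hT3, hTM, hTJ, hjunk]

/-- **The range condition** `e^{b(a log Q + log(T₁+4))} ≤ X^{1/2}` for `T₁ = X^θ`, `θ b ≤ 1/8`,
`a log Q ≤ θ L ≤ θ L_X`, `2 ≤ θ L` (a copy of `window_range`, gen 5, with a general collar `ε > 0`). [folklore] -/
theorem frobWindow_range {Q L θ a b lo hi T₁ ε LX : ℝ} (hb : 0 < b)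
    (hθ0 : 0 < θ) (hθb : θ * b ≤ 1 / 8) (hθ1 : θ ≤ 1 / 8)
    (haθ : a * Real.log Q ≤ θ * L) (h2θ : 2 ≤ θ * L)
    (hlo : L ≤ lo) (hlohi : lo < hi)
    (hε0 : 0 < ε) (hLX : LX = hi + ε) (hT₁ : T₁ = Real.exp (θ * LX)) :
    Real.exp (b * (a * Real.log Q + Real.log (T₁ + 4))) ≤ Real.exp LX ^ ((1 : ℝ) / 2) := by
  obtain ⟨hlog6, -, -⟩ := log_small_consts
  have hθL8 : θ * L ≤ L / 8 := by
    have hL0' : 0 ≤ L := by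
      by_contra h; rw [not_le] at h
      have := mul_neg_of_pos_of_neg hθ0 h; linarith
    have := mul_le_mul_of_nonneg_right hθ1 hL0'; linarith
  have hL16 : 16 ≤ L := by linarith
  have hLXL : L ≤ LX := by rw [hLX]; linarith
  have hLX0 : 0 < LX := by linarith
  have hθLX : 0 ≤ θ * LX := by positivity
  have hT₁1 : 1 ≤ T₁ := by rw [hT₁]; exact Real.one_le_exp hθLX
  have hθLXL : θ * L ≤ θ * LX := mul_le_mul_of_nonneg_left hLXL hθ0.le
  have hlogT4 : Real.log (T₁ + 4) ≤ θ * LX + 2 := by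
    have h2 : Real.log (T₁ + 4) ≤ Real.log (6 * T₁) := Real.log_le_log (by linarith) (by linarith)
    rw [Real.log_mul (by norm_num) (by linarith), hT₁, Real.log_exp] at h2
    rw [hT₁]; linarith
  have hden : a * Real.log Q + Real.log (T₁ + 4) ≤ 3 * (θ * LX) := by linarith
  rw [← Real.exp_mul]
  refine Real.exp_le_exp.2 ?_
  have h1 : b * (a * Real.log Q + Real.log (T₁ + 4)) ≤ b * (3 * (θ * LX)) :=
    mul_le_mul_of_nonneg_left hden hb.le
  have h2 : b * (3 * (θ * LX)) = 3 * (θ * b) * LX := by ring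
  have h3 := mul_le_mul_of_nonneg_right hθb (by linarith : (0 : ℝ) ≤ 3 * LX)
  have h4 : b * (3 * (θ * LX)) = θ * b * (3 * LX) := by ring
  have h5 : LX * (1 / 2 : ℝ) = LX / 2 := by ring
  rw [h5]; linarith




end Summit.QuantumAdvantage.QuantumAdvantage.Theorems.DegreeOnePrimesEscape

end
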